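import Literature.Analysis.FluidPDE.Wei2016JLink
import HarnessLib

/-!
# The swirl gradient of an axisymmetric field in terms of its curl (Majda–Bertozzi (2.64))

Analysis/FluidPDE proof file (theorems only; no definitions, no named facts).

For an axisymmetric field `v = vʳ eᵣ + v^θ e_θ + v³ e₃` Majda–Bertozzi record the vorticity in the cylindrical frame,

> (2.64) `ω = curl v = −v^θ_{x₃} eᵣ + ω^θ e_θ + r⁻¹(r v^θ)ᵣ e₃`, `ω^θ = vʳ_{x₃} − v³ᵣ`,

i.e. the meridional gradient of the swirl `Γ = r v^θ` (the tree's junk-free `swirl v = x₀v₁ − x₁v₀`) is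
`∂ᵣΓ = r ω³`, `∂_{x₃}Γ = −r ωʳ`. This file proves the Cartesian rendering of the `eᵣ`/`e₃` components of (2.64) at
every point of differentiability of an axisymmetric `u : ℝ³ → ℝ³` (`IsAxisymmetric u`), and its pointwise norm form:

* `IsAxisymmetric.fderiv_swirl_apply_eq_curl` — `DΓ(x)h = ω₂(x)(x₀h₀ + x₁h₁) − (x₀ω₀(x) + x₁ω₁(x)) h₂`
  (the `h₂`-part alone is the tree's `Wei2016.horizontal_inner_curl_eq`);
* `IsAxisymmetric.abs_fderiv_swirl_apply_le` — `|DΓ(x)h| ≤ r(x)‖ω(x)‖‖h‖`, and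
  `IsAxisymmetric.norm_fderiv_swirl_le_cylRadius_mul_norm_curl` — `‖DΓ(x)‖ ≤ r(x)‖ω(x)‖`
  (from (2.64): `|∇Γ| = r √((ωʳ)² + (ω³)²) ≤ r|ω|`; the swirl gradient is controlled by the CURL alone — compare the
  tree's `IsAxisymmetric.abs_swirl_le_mul_norm_fderiv`, `|Γ| ≤ r²‖Du‖`, which uses the full velocity gradient);
* `curl_rotGen_eq`, `norm_curl_rotGen`, `swirl_rotGen_eq_cylRadius_sq` — Majda–Bertozzi's rotating example
  (eq. (1.27), used again in §2.3.3): the rigid rotation `v = ½ω r e_θ` has vorticity `ω e₃`; here with `ω = 2`,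
  `v(x) = Jx = (−x₁, x₀, 0)`: `curl J ≡ 2e₃`, `Γ = r²`.

Proof of the identity: `DΓ(x)h = ⟪Jx, Du(x)h⟫ + ⟪Jh, u(x)⟫` (`fderiv_swirl_apply`) and the three components of the
infinitesimal axisymmetry `Du(x)[Jx] = J u(x)` (`IsAxisymmetric.fderiv_rotGen`). The integrated consequences
(`|Γ(x)| ≤ ½ r² sup‖ω‖` on the radial segment, `|u_θ/r| ≤ ½ sup‖ω‖`, sharp on the rigid rotation) are NOT printed
statements and live on the Summits side (`Summits/NavierStokesRegularity/OSWSelfSimilar/AxisymAngularVelocityHalfVorticity`).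

## References

* A. J. Majda, A. L. Bertozzi, *Vorticity and Incompressible Flow*, Cambridge Texts in Applied Mathematics, CUP 2002,
  §2.3.3 "Axisymmetric flows with a general swirl", eq. (2.63)–(2.64), and the rotating jet example (eqs. (1.25), (1.27))
  following (2.68). [MajdaBertozziCUP2002]
* G. Koch, N. Nadirashvili, G. Seregin, V. Šverák, Acta Math. 203 (2009) 83–105, §1 (1.5)–(1.8) (cylindrical frame,
  `Γ = r u_θ`). [KNSS2009]
-/

noncomputable section

open Set Function Filter
open scoped RealInnerProductSpace

namespace Literature.Analysis.FluidPDE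

/-! ### Two coordinate helpers -/

/-- `‖w‖² = w₀² + w₁² + w₂²` on `ℝ³`. [folklore] -/
private theorem norm_sq_eq_add_three (w : EuclideanSpace ℝ (Fin 3)) : ‖w‖ ^ 2 = w 0 ^ 2 + w 1 ^ 2 + w 2 ^ 2 := by
  rw [EuclideanSpace.norm_sq_eq, Fin.sum_univ_three]
  simp only [Real.norm_eq_abs, sq_abs]

/-- A vector of `ℝ³` in the standard basis: `h = h₀e₀ + h₁e₁ + h₂e₂`. [folklore] -/
private theorem eq_sum_smul_single_three (h : EuclideanSpace ℝ (Fin 3)) :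
    h = h 0 • EuclideanSpace.single 0 (1 : ℝ) + h 1 • EuclideanSpace.single 1 (1 : ℝ) +
      h 2 • EuclideanSpace.single 2 (1 : ℝ) := by
  ext i
  fin_cases i <;> simp

/-! ### The swirl gradient in terms of the curl -/

section Gradient

variable {u : EuclideanSpace ℝ (Fin 3) → EuclideanSpace ℝ (Fin 3)} {x : EuclideanSpace ℝ (Fin 3)}

/-- **The swirl gradient of an axisymmetric field in terms of its curl** (Cartesian form of the `eᵣ`/`e₃`
components `ωʳ = −∂_{x₃}v^θ`, `ω³ = r⁻¹∂ᵣ(r v^θ)` of Majda–Bertozzi (2.64), with `Γ = r v^θ`): at every point where `u` is differentiable,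
`DΓ(x)h = ω₂(x)(x₀h₀ + x₁h₁) − (x₀ω₀(x) + x₁ω₁(x)) h₂`, `Γ = swirl u`, `ω = FluidPDE.curl u`. Proof: `DΓ(x)h = ⟪Jx, Du(x)h⟫ + ⟪Jh, u x⟫`
(`fderiv_swirl_apply`) and the three components of the infinitesimal axisymmetry `Du(x)[Jx] = J(u x)`
(`IsAxisymmetric.fderiv_rotGen`). [cite: MajdaBertozziCUP2002, §2.3.3 eq. (2.64)] -/
theorem IsAxisymmetric.fderiv_swirl_apply_eq_curl (hax : IsAxisymmetric u) (hd : DifferentiableAt ℝ u x)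
    (h : EuclideanSpace ℝ (Fin 3)) :
    fderiv ℝ (swirl u) x h =
      FluidPDE.curl u x 2 * (x 0 * h 0 + x 1 * h 1) - (x 0 * FluidPDE.curl u x 0 + x 1 * FluidPDE.curl u x 1) * h 2 := by
  -- the three components of `Du(x)[Jx] = J u(x)`
  have hJ := hax.fderiv_rotGen hd
  rw [rotGen_eq_sub_single, map_sub, map_smul, map_smul] at hJ
  have hA := congrArg (fun v : EuclideanSpace ℝ (Fin 3) => v 0) hJ
  have hB := congrArg (fun v : EuclideanSpace ℝ (Fin 3) => v 1) hJ
  have hC := congrArg (fun v : EuclideanSpace ℝ (Fin 3) => v 2) hJ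
  simp only [PiLp.sub_apply, PiLp.smul_apply, smul_eq_mul, rotGen_apply_zero, rotGen_apply_one,
    rotGen_apply_two] at hA hB hC
  -- expand `Du(x)h` in the standard basis
  have hlin : fderiv ℝ u x h = h 0 • fderiv ℝ u x (EuclideanSpace.single 0 1) +
      h 1 • fderiv ℝ u x (EuclideanSpace.single 1 1) + h 2 • fderiv ℝ u x (EuclideanSpace.single 2 1) := by
    conv_lhs => rw [eq_sum_smul_single_three h]
    simp only [map_add, map_smul]
  have hω0 : FluidPDE.curl u x 0 = fderiv ℝ u x (EuclideanSpace.single 1 1) 2 - fderiv ℝ u x (EuclideanSpace.single 2 1) 1 := by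
    simp [FluidPDE.curl]
  have hω1 : FluidPDE.curl u x 1 = fderiv ℝ u x (EuclideanSpace.single 2 1) 0 - fderiv ℝ u x (EuclideanSpace.single 0 1) 2 := by
    simp [FluidPDE.curl]
  have hω2 : FluidPDE.curl u x 2 = fderiv ℝ u x (EuclideanSpace.single 0 1) 1 - fderiv ℝ u x (EuclideanSpace.single 1 1) 0 := by
    simp [FluidPDE.curl]
  rw [fderiv_swirl_apply hd, inner_rotGen_left, inner_rotGen_left, hlin, hω0, hω1, hω2]
  simp only [PiLp.add_apply, PiLp.smul_apply, smul_eq_mul]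
  linear_combination h 0 * hA + h 1 * hB + h 2 * hC

set_option maxHeartbeats 400000 in
/-- **`|DΓ(x)h| ≤ r(x)‖ω(x)‖‖h‖`** for an axisymmetric field differentiable at `x`: by
`fderiv_swirl_apply_eq_curl` and two Cauchy–Schwarz inequalities in the horizontal plane — the norm form
`|∇Γ| = r√((ωʳ)² + (ω³)²) ≤ r|ω|` of Majda–Bertozzi (2.64). [cite: MajdaBertozziCUP2002, §2.3.3 eq. (2.64)] -/
theorem IsAxisymmetric.abs_fderiv_swirl_apply_le (hax : IsAxisymmetric u) (hd : DifferentiableAt ℝ u x)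
    (h : EuclideanSpace ℝ (Fin 3)) :
    |fderiv ℝ (swirl u) x h| ≤ cylRadius x * ‖FluidPDE.curl u x‖ * ‖h‖ := by
  rw [hax.fderiv_swirl_apply_eq_curl hd h]
  set ω := FluidPDE.curl u x with hω_def
  have hωn : ‖ω‖ ^ 2 = ω 0 ^ 2 + ω 1 ^ 2 + ω 2 ^ 2 := norm_sq_eq_add_three ω
  have hhn : ‖h‖ ^ 2 = h 0 ^ 2 + h 1 ^ 2 + h 2 ^ 2 := norm_sq_eq_add_three h
  have hR : cylRadius x ^ 2 = x 0 ^ 2 + x 1 ^ 2 := cylRadius_sq x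
  -- the polynomial inequality `(ω₂A − Bh₂)² ≤ r²‖ω‖²‖h‖²`
  have key : (ω 2 * (x 0 * h 0 + x 1 * h 1) - (x 0 * ω 0 + x 1 * ω 1) * h 2) ^ 2 ≤
      (x 0 ^ 2 + x 1 ^ 2) * ((ω 0 ^ 2 + ω 1 ^ 2 + ω 2 ^ 2) * (h 0 ^ 2 + h 1 ^ 2 + h 2 ^ 2)) := by
    set R := x 0 ^ 2 + x 1 ^ 2 with hR_def
    set A := x 0 * h 0 + x 1 * h 1 with hA_def
    set B := x 0 * ω 0 + x 1 * ω 1 with hB_def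
    set Sp := x 0 * h 1 - x 1 * h 0 with hSp_def
    set Sq := x 0 * ω 1 - x 1 * ω 0 with hSq_def
    have hR0 : 0 ≤ R := by positivity
    rcases eq_or_lt_of_le hR0 with hR0' | hRpos
    · have hx0 : x 0 = 0 := by nlinarith [sq_nonneg (x 0), sq_nonneg (x 1)]
      have hx1 : x 1 = 0 := by nlinarith [sq_nonneg (x 0), sq_nonneg (x 1)]
      simp [hA_def, hB_def, hR_def, hx0, hx1]
    · -- `R · (R‖ω‖²‖h‖² − (ω₂A − Bh₂)²)` is an explicit sum of squares
      have hid : R * (R * ((ω 0 ^ 2 + ω 1 ^ 2 + ω 2 ^ 2) * (h 0 ^ 2 + h 1 ^ 2 + h 2 ^ 2)) -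
          (ω 2 * A - B * h 2) ^ 2) =
          A ^ 2 * Sq ^ 2 + Sp ^ 2 * B ^ 2 + Sp ^ 2 * Sq ^ 2 + R * ω 2 ^ 2 * Sp ^ 2 + R * h 2 ^ 2 * Sq ^ 2 +
            (R * h 2 * ω 2 + A * B) ^ 2 := by
        simp only [hR_def, hA_def, hB_def, hSp_def, hSq_def]
        ring
      have hnn : 0 ≤ R * (R * ((ω 0 ^ 2 + ω 1 ^ 2 + ω 2 ^ 2) * (h 0 ^ 2 + h 1 ^ 2 + h 2 ^ 2)) -
          (ω 2 * A - B * h 2) ^ 2) := by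
        rw [hid]; positivity
      nlinarith
  have hsq : (ω 2 * (x 0 * h 0 + x 1 * h 1) - (x 0 * ω 0 + x 1 * ω 1) * h 2) ^ 2 ≤
      (cylRadius x * ‖ω‖ * ‖h‖) ^ 2 := by
    calc _ ≤ (x 0 ^ 2 + x 1 ^ 2) * ((ω 0 ^ 2 + ω 1 ^ 2 + ω 2 ^ 2) * (h 0 ^ 2 + h 1 ^ 2 + h 2 ^ 2)) := key
      _ = (cylRadius x * ‖ω‖ * ‖h‖) ^ 2 := by rw [mul_pow, mul_pow, hR, hωn, hhn]; ring
  exact abs_le_of_sq_le_sq hsq (mul_nonneg (mul_nonneg (cylRadius_nonneg x) (norm_nonneg _)) (norm_nonneg _))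

/-- **`‖DΓ(x)‖ ≤ r(x)‖ω(x)‖`**: the operator norm of the swirl gradient of an axisymmetric field is bounded by the
distance to the axis times the vorticity (cylindrically `|∇Γ| = r√((ωʳ)² + (ω³)²)`, Majda–Bertozzi (2.64)).
[cite: MajdaBertozziCUP2002, §2.3.3 eq. (2.64)] -/
theorem IsAxisymmetric.norm_fderiv_swirl_le_cylRadius_mul_norm_curl (hax : IsAxisymmetric u) (hd : DifferentiableAt ℝ u x) :
    ‖fderiv ℝ (swirl u) x‖ ≤ cylRadius x * ‖FluidPDE.curl u x‖ :=
  ContinuousLinearMap.opNorm_le_bound _ (mul_nonneg (cylRadius_nonneg x) (norm_nonneg _)) fun h => by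
    rw [Real.norm_eq_abs]
    exact hax.abs_fderiv_swirl_apply_le hd h

end Gradient

/-! ### The rotating example -/

section Rigid

/-- **Majda–Bertozzi's rotating example**: the rigid rotation `x ↦ Jx = (−x₁, x₀, 0) = r e_θ` (their `v = ½ω r e_θ`
with `ω = 2`) has the constant vorticity `2e₃`. [cite: MajdaBertozziCUP2002, §2.3.3 eq. (1.27) (the rotating jet example after (2.68))] -/
theorem curl_rotGen_eq (x : EuclideanSpace ℝ (Fin 3)) : FluidPDE.curl rotGen x = EuclideanSpace.single 2 (2 : ℝ) := by
  have hD : fderiv ℝ rotGen x = rotGenL := (hasFDerivAt_rotGen x).fderiv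
  ext i
  fin_cases i
  · simp [FluidPDE.curl, hD, rotGen_single_one, rotGen_single_two]
  · simp [FluidPDE.curl, hD, rotGen_single_zero, rotGen_single_two]
  · simp [FluidPDE.curl, hD, rotGen_single_zero, rotGen_single_one]
    norm_num

/-- The vorticity of the rigid rotation `x ↦ Jx` has norm `2` at every point. [cite: MajdaBertozziCUP2002, §2.3.3 eq. (1.27) (the rotating jet example after (2.68))] -/
theorem norm_curl_rotGen (x : EuclideanSpace ℝ (Fin 3)) : ‖FluidPDE.curl rotGen x‖ = 2 := by
  have h : ‖FluidPDE.curl rotGen x‖ ^ 2 = 4 := by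
    rw [norm_sq_eq_add_three, curl_rotGen_eq]; simp; norm_num
  nlinarith [norm_nonneg (FluidPDE.curl rotGen x)]

/-- The rigid rotation `x ↦ Jx = r e_θ` has swirl `Γ(x) = r · r = x₀² + x₁² = r(x)²` (`v^θ = r`, `Γ = r v^θ`).
[cite: MajdaBertozziCUP2002, §2.3.3 eq. (1.27) (the rotating jet example after (2.68))] -/
theorem swirl_rotGen_eq_cylRadius_sq (x : EuclideanSpace ℝ (Fin 3)) : swirl rotGen x = cylRadius x ^ 2 := by
  rw [cylRadius_sq, swirl, rotGen_apply_zero, rotGen_apply_one]; ring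

end Rigid

end Literature.Analysis.FluidPDE
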